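import Mathlib
import HarnessLib
import Summits.Ventures.LatticeQCDFlow.Exactness.CPNHeatBathErgodic

/-!
# The CP(N−1) heat-bath sweep for the Symanzik-improved (two-link) action also converges from every start

HONEST FRAMING: exact (Metropolis-corrected) sampling algorithms for lattice gauge theory;
figures of merit are autocorrelation/cost numbers at stated couplings and volumes; no
continuum-physics claim.

Venture `LatticeQCDFlow` (cell pub-lqcd), topic `Exactness`, FANOUT row 9 (eng-latcore, the
engine `latflow.core`).  NEW WORK of the cell over row 9's `CPNHeatBathErgodic.lean` (configuration
space, standard action, the instance of `HeatBathSweepCompact.lean` / `DoeblinUniqueness.lean`).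
Nothing is cited as a fact.

`CPNHeatBathErgodic.lean` left the engine's second action token NOT CLAIMED: `symanzik-tree`
(`cpn_2d.py`), which adds TWO-LINK terms `c′_p Re(z̄_s λ_{e₁} λ_{e₂} z_t)` along straight paths
`p = (e₁, e₂)` of length two.  Realified with the complex structure `J`, the product of two unit complex
numbers is `(λλ′)₀ = λ₀λ′₀ − λ₁λ′₁`, `(λλ′)₁ = λ₀λ′₁ + λ₁λ′₀`, and the term is
`c′_p((λλ′)₀⟨z_s, z_t⟩ − (λλ′)₁⟨z_s, J z_t⟩)` — a polynomial in the coordinates, so the action stays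
CONTINUOUS on the compact configuration space and row 9's theorems apply verbatim:

* `hopTerm`, **`cpnAction₂`** = `cpnAction − Σ_p hopTerm p`; `continuous_cpnAction₂`;
* **`cpn₂_heatBathSweep_uniformlyErgodic`**, **`cpn₂_heatBathSweep_comp_uniformlyErgodic`**,
  **`cpn₂GibbsLaw_unique_invariant`** — the sweep of exact single-variable heat baths (each site and
  link conditional is still linear in the updated variable, hence vMF / von Mises: the engine's
  samplers) converges to the improved-action lattice law from every start; unique invariant law.

The path set `P` with its links `e₁ e₂ : P → E` and endpoints `s t : P → V` is abstract (the engine: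
`p = (x, μ)`, `e₁ = (x, μ)`, `e₂ = (x + μ̂, μ)`, `s = x`, `t = x + 2μ̂`, `c′ = −c/16`-type weights —
values not restated).  NOT CLAIMED: the conditional bookkeeping for this action (as in
`CPNSiteConditional.lean` / `CPNLinkConditional.lean`; the same linear structure), rates, floating point.
-/

namespace Summit.Ventures.LatticeQCDFlow.Exactness

open MeasureTheory ProbabilityTheory Metric
open scoped ENNReal InnerProductSpace

section Symanzik

variable {V E P : Type*} [Fintype V] [Fintype E] [Fintype P] [DecidableEq V] [DecidableEq E] {d : ℕ}
  (src tgt : E → V) (J : EuclideanSpace ℝ (Fin (d + 2)) →L[ℝ] EuclideanSpace ℝ (Fin (d + 2))) (c : E → ℝ)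
  (e₁ e₂ : P → E) (s t : P → V) (c₂ : P → ℝ)

/-- **The two-link term of path `p`**: `c′_p((λλ′)₀⟨z_s, z_t⟩ − (λλ′)₁⟨z_s, J z_t⟩)` with the realified
complex product `(λλ′)₀ = λ₀λ′₀ − λ₁λ′₁`, `(λλ′)₁ = λ₀λ′₁ + λ₁λ′₀`. -/
noncomputable def hopTerm (ω : CPNConfig V E d) (p : P) : ℝ :=
  c₂ p * ((linkVec ω (e₁ p) 0 * linkVec ω (e₂ p) 0 - linkVec ω (e₁ p) 1 * linkVec ω (e₂ p) 1) *
      ⟪siteVec ω (s p), siteVec ω (t p)⟫_ℝ -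
    (linkVec ω (e₁ p) 0 * linkVec ω (e₂ p) 1 + linkVec ω (e₁ p) 1 * linkVec ω (e₂ p) 0) *
      ⟪siteVec ω (s p), J (siteVec ω (t p))⟫_ℝ)

/-- **The Symanzik-improved CP(N−1) action**: the standard action plus the two-link terms. -/
noncomputable def cpnAction₂ (ω : CPNConfig V E d) : ℝ :=
  cpnAction src tgt J c ω - ∑ p, hopTerm J e₁ e₂ s t c₂ ω p

omit [Fintype V] [Fintype E] [Fintype P] [DecidableEq V] [DecidableEq E] in
/-- Each two-link term is continuous in the configuration. -/
theorem continuous_hopTerm (p : P) : Continuous fun ω : CPNConfig V E d => hopTerm J e₁ e₂ s t c₂ ω p := by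
  unfold hopTerm
  have hl : ∀ (e : E) (i : Fin 2), Continuous fun ω : CPNConfig V E d => linkVec ω e i := fun e i =>
    (EuclideanSpace.proj i).continuous.comp (continuous_linkVec e)
  have h1 : Continuous fun ω : CPNConfig V E d => ⟪siteVec ω (s p), siteVec ω (t p)⟫_ℝ :=
    (continuous_siteVec (s p)).inner (continuous_siteVec (t p))
  have h2 : Continuous fun ω : CPNConfig V E d => ⟪siteVec ω (s p), J (siteVec ω (t p))⟫_ℝ :=
    (continuous_siteVec (s p)).inner (J.continuous.comp (continuous_siteVec (t p)))
  exact continuous_const.mul (((((hl _ 0).mul (hl _ 0)).sub ((hl _ 1).mul (hl _ 1))).mul h1).sub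
    ((((hl _ 0).mul (hl _ 1)).add ((hl _ 1).mul (hl _ 0))).mul h2))

omit [Fintype V] [DecidableEq V] [DecidableEq E] in
/-- **The improved action is continuous.** -/
theorem continuous_cpnAction₂ : Continuous (cpnAction₂ src tgt J c e₁ e₂ s t c₂) := by
  unfold cpnAction₂
  exact (continuous_cpnAction src tgt J c).sub (continuous_finsetSum _ fun p _ => continuous_hopTerm J e₁ e₂ s t c₂ p)

/-- **The improved-action lattice CP(N−1) law.** -/
noncomputable def cpn₂GibbsLaw : Measure (CPNConfig V E d) :=
  piGibbsLaw (cpnRef V E d) (gibbsDensity (cpnAction₂ src tgt J c e₁ e₂ s t c₂))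

/-- **THE HEAT-BATH SWEEP OF THE IMPROVED ACTION CONVERGES FROM EVERY START** (explicit `ε ∈ (0,1]`,
geometric, setwise). -/
theorem cpn₂_heatBathSweep_uniformlyErgodic {l : List (V ⊕ E)} (hl : ∀ i, i ∈ l) :
    ∃ ε : ℝ, 0 < ε ∧ ε ≤ 1 ∧ ∀ (μ₀ : Measure (CPNConfig V E d)) [IsProbabilityMeasure μ₀] (n : ℕ)
      (A : Set (CPNConfig V E d)),
      |((fun ν : Measure (CPNConfig V E d) => ν.bind (cycle (l.map (siteHeatBath (cpnRef V E d)
          (gibbsDensity (cpnAction₂ src tgt J c e₁ e₂ s t c₂))))))^[n] μ₀).real A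
          - (cpn₂GibbsLaw src tgt J c e₁ e₂ s t c₂).real A| ≤ (1 - ε) ^ n :=
  heatBathSweep_uniformlyErgodic_of_continuous (μ := cpnRef V E d)
    (continuous_cpnAction₂ src tgt J c e₁ e₂ s t c₂) hl

/-- **… and so does the composite sweep** (followed by any exact kernel, e.g. over-relaxation). -/
theorem cpn₂_heatBathSweep_comp_uniformlyErgodic {l : List (V ⊕ E)} (hl : ∀ i, i ∈ l)
    (η : Kernel (CPNConfig V E d) (CPNConfig V E d)) [IsMarkovKernel η]
    (hη : Kernel.Invariant η ((Measure.pi (cpnRef V E d)).withDensity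
      (gibbsDensity (cpnAction₂ src tgt J c e₁ e₂ s t c₂)))) :
    ∃ ε : ℝ, 0 < ε ∧ ε ≤ 1 ∧ ∀ (μ₀ : Measure (CPNConfig V E d)) [IsProbabilityMeasure μ₀] (n : ℕ)
      (A : Set (CPNConfig V E d)),
      |((fun ν : Measure (CPNConfig V E d) => ν.bind (η ∘ₖ cycle (l.map (siteHeatBath (cpnRef V E d)
          (gibbsDensity (cpnAction₂ src tgt J c e₁ e₂ s t c₂))))))^[n] μ₀).real A
          - (cpn₂GibbsLaw src tgt J c e₁ e₂ s t c₂).real A| ≤ (1 - ε) ^ n :=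
  heatBathSweep_comp_uniformlyErgodic_of_continuous (μ := cpnRef V E d)
    (continuous_cpnAction₂ src tgt J c e₁ e₂ s t c₂) hl η hη

/-- **The improved-action law is the unique invariant probability law of the sweep.** -/
theorem cpn₂GibbsLaw_unique_invariant {l : List (V ⊕ E)} (hl : ∀ i, i ∈ l)
    {π' : Measure (CPNConfig V E d)} [IsProbabilityMeasure π']
    (hπ' : Kernel.Invariant (cycle (l.map (siteHeatBath (cpnRef V E d)
      (gibbsDensity (cpnAction₂ src tgt J c e₁ e₂ s t c₂))))) π') :
    π' = cpn₂GibbsLaw src tgt J c e₁ e₂ s t c₂ := by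
  have hS := continuous_cpnAction₂ src tgt J c e₁ e₂ s t c₂
  rcases isEmpty_or_nonempty (CPNConfig V E d) with hE | hne
  · exact absurd (measure_univ (μ := π')) (by rw [Set.univ_eq_empty_iff.2 hE, measure_empty]; exact zero_ne_one)
  obtain ⟨ωa, -, hmin⟩ := isCompact_univ.exists_isMinOn Set.univ_nonempty hS.continuousOn
  obtain ⟨ωb, -, hmax⟩ := isCompact_univ.exists_isMaxOn Set.univ_nonempty hS.continuousOn
  have hωa : ∀ ω, cpnAction₂ src tgt J c e₁ e₂ s t c₂ ωa ≤ cpnAction₂ src tgt J c e₁ e₂ s t c₂ ω :=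
    fun ω => (isMinOn_iff.1 hmin) ω (Set.mem_univ ω)
  have hωb : ∀ ω, cpnAction₂ src tgt J c e₁ e₂ s t c₂ ω ≤ cpnAction₂ src tgt J c e₁ e₂ s t c₂ ωb :=
    fun ω => (isMaxOn_iff.1 hmax) ω (Set.mem_univ ω)
  exact heatBathSweep_invariant_unique (μ := cpnRef V E d) (measurable_gibbsDensity hS)
    (m := ENNReal.ofReal (Real.exp (-(cpnAction₂ src tgt J c e₁ e₂ s t c₂ ωb))))
    (M := ENNReal.ofReal (Real.exp (-(cpnAction₂ src tgt J c e₁ e₂ s t c₂ ωa))))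
    (by rw [Ne, ENNReal.ofReal_eq_zero, not_le]; exact Real.exp_pos _) ENNReal.ofReal_ne_top
    (fun ω => (gibbsDensity_bounds hωa hωb ω).1) (fun ω => (gibbsDensity_bounds hωa hωb ω).2) hl hπ'

end Symanzik

end Summit.Ventures.LatticeQCDFlow.Exactness
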